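import Mathlib
import HarnessLib

/-!
# A weighted Liouville theorem (crux `BoundaryClosureR`, stmt-CriticalPhenomena-14004,
# line `polygon-parity-squeeze`, registered sub-goal `entire_eq_const_of_integrable_weight`)

An entire function `H : ℂ → ℂ` with `∫_ℂ ‖H w‖ (1 + ‖w‖) ^ (-γ) dA(w) < ∞` for some `γ < 3` is
constant.  This is the analysis endgame of `stub_polygonIdentification` (mechanism (A) of the
line): after reflection across the sides and removal of the corner singularities one is left
with an entire function whose only control at `∞` is a weighted `L¹` bound with exponent
`γ = 11 / 4 < 3` coming from the `L¹` integrability of the weak limit near the root.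

Proof (folklore).  Cauchy's formula for the derivative on the circle `|z - w₀| = r` gives the
`L¹` estimate `2π r ‖H'(w₀)‖ ≤ ∫_{-π}^{π} ‖H(w₀ + r e^{iθ})‖ dθ`; multiplying by `r` and
integrating over `r ∈ [R, 2R]` (Tonelli in polar coordinates,
`Complex.lintegral_comp_polarCoord_symm`) bounds `2π R³ ‖H'(w₀)‖` by the integral of `‖H‖`
over the disc `|w - w₀| ≤ 2R`, hence by `(1 + ‖w₀‖ + 2R) ^ γ ∫ ‖H‖ (1 + ‖·‖) ^ (-γ)`
(translation invariance of Lebesgue measure).  Since `γ < 3`, letting `R → ∞` forces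
`H' ≡ 0`, so `H` is constant (`is_const_of_deriv_eq_zero`).
-/

noncomputable section

open scoped Real Topology ENNReal
open Filter Set MeasureTheory Metric

namespace Summit.CriticalPhenomena.SAWScalingLimit.Theorems.PolygonParitySqueeze.Analysis

/-- **Cauchy's `L¹` estimate on a circle.**  For an entire `H`, `w₀ ∈ ℂ` and `r > 0`,
`2π r ‖H'(w₀)‖ ≤ ∫_{-π}^{π} ‖H(w₀ + r e^{iθ})‖ dθ`: the Cauchy formula
`2πi H'(w₀) = ∮ H(z) (z - w₀)⁻² dz` with `|dz| = r dθ` and `|z - w₀| = r`, the angle integral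
shifted to `(-π, π]` by periodicity. [folklore] -/
theorem two_pi_mul_norm_deriv_le_intervalIntegral {H : ℂ → ℂ} (hH : Differentiable ℂ H)
    (w₀ : ℂ) {r : ℝ} (hr : 0 < r) :
    2 * π * r * ‖deriv H w₀‖ ≤ ∫ θ in (-π)..π, ‖H (circleMap w₀ r θ)‖ := by
  have hC := (hH.differentiableOn (s := closedBall w₀ r)).deriv_eq_smul_circleIntegral hr
  have hper : ∫ θ in (0 : ℝ)..2 * π, ‖H (circleMap w₀ r θ)‖ =
      ∫ θ in (-π)..π, ‖H (circleMap w₀ r θ)‖ := by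
    have h := ((periodic_circleMap w₀ r).comp fun z => ‖H z‖).intervalIntegral_add_eq 0 (-π)
    have e1 : (0 : ℝ) + 2 * π = 2 * π := by ring
    have e2 : -π + 2 * π = π := by ring
    rw [e1, e2] at h
    exact h
  have hnorm : ‖(2 * π * Complex.I : ℂ) • deriv H w₀‖ = 2 * π * ‖deriv H w₀‖ := by
    rw [norm_smul]
    simp [Real.pi_pos.le]
  have hr0 : r ≠ 0 := hr.ne'
  have hpt : ∀ θ : ℝ, ‖deriv (circleMap w₀ r) θ •
      ((1 / (circleMap w₀ r θ - w₀) ^ 2) • H (circleMap w₀ r θ))‖ =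
        r⁻¹ * ‖H (circleMap w₀ r θ)‖ := by
    intro θ
    rw [norm_smul, norm_smul, deriv_circleMap, circleMap_sub_center, norm_mul, Complex.norm_I,
      mul_one, norm_div, norm_one, norm_pow, norm_circleMap_zero, abs_of_pos hr]
    field_simp
  calc 2 * π * r * ‖deriv H w₀‖
      = r * ‖∮ z in C(w₀, r), (1 / (z - w₀) ^ 2) • H z‖ := by rw [hC, hnorm]; ring
    _ ≤ r * ∫ θ in (0 : ℝ)..2 * π, ‖deriv (circleMap w₀ r) θ •
          ((1 / (circleMap w₀ r θ - w₀) ^ 2) • H (circleMap w₀ r θ))‖ := by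
        gcongr
        exact intervalIntegral.norm_integral_le_integral_norm Real.two_pi_pos.le
    _ = r * ∫ θ in (0 : ℝ)..2 * π, r⁻¹ * ‖H (circleMap w₀ r θ)‖ := by simp only [hpt]
    _ = ∫ θ in (-π)..π, ‖H (circleMap w₀ r θ)‖ := by
        rw [intervalIntegral.integral_const_mul, ← mul_assoc, mul_inv_cancel₀ hr0, one_mul, hper]

/-- **Cauchy's `L¹` estimate, `ℝ≥0∞` form.**  For an entire `H`, `w₀ ∈ ℂ` and `r > 0`,
`2π r ‖H'(w₀)‖ ≤ ∫⁻_{θ ∈ (-π, π)} ‖H(w₀ + r e^{iθ})‖`. [folklore] -/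
theorem ofReal_two_pi_mul_norm_deriv_le_lintegral {H : ℂ → ℂ} (hH : Differentiable ℂ H)
    (w₀ : ℂ) {r : ℝ} (hr : 0 < r) :
    ENNReal.ofReal (2 * π * r * ‖deriv H w₀‖) ≤
      ∫⁻ θ in Ioo (-π) π, ‖H (circleMap w₀ r θ)‖ₑ := by
  have hcont : Continuous fun θ : ℝ => ‖H (circleMap w₀ r θ)‖ :=
    (hH.continuous.comp (continuous_circleMap w₀ r)).norm
  have h1 := two_pi_mul_norm_deriv_le_intervalIntegral hH w₀ hr
  rw [intervalIntegral.integral_of_le (by linarith [Real.pi_pos])] at h1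
  calc ENNReal.ofReal (2 * π * r * ‖deriv H w₀‖)
      ≤ ENNReal.ofReal (∫ θ in Ioc (-π) π, ‖H (circleMap w₀ r θ)‖) :=
        ENNReal.ofReal_le_ofReal h1
    _ = ∫⁻ θ in Ioc (-π) π, ‖H (circleMap w₀ r θ)‖ₑ := by
        rw [ofReal_integral_eq_lintegral_ofReal hcont.integrableOn_Ioc
          (Eventually.of_forall fun _ => norm_nonneg _)]
        simp only [ofReal_norm]
    _ = ∫⁻ θ in Ioo (-π) π, ‖H (circleMap w₀ r θ)‖ₑ := setLIntegral_congr Ioo_ae_eq_Ioc.symm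

/-- The circle parametrisation is the shifted inverse polar-coordinate map:
`circleMap w₀ r θ = w₀ + r (cos θ + i sin θ)`. [folklore] -/
theorem circleMap_eq_add_polarCoord_symm (w₀ : ℂ) (r θ : ℝ) :
    circleMap w₀ r θ = w₀ + Complex.polarCoord.symm (r, θ) := by
  simp [circleMap, Complex.exp_mul_I]

/-- **Averaging Cauchy's estimate over the annulus `R ≤ |w - w₀| ≤ 2R`.**  For an entire `H`,
`w₀ ∈ ℂ` and `R > 0`, `2π R³ ‖H'(w₀)‖ ≤ ∫_{|w| ≤ 2R} ‖H(w₀ + w)‖ dA(w)` (in `ℝ≥0∞`):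
multiply the circle estimate at radius `r ∈ [R, 2R]` by `r ≥ R`, integrate in `r`, and
recognise the area integral over the annulus by Tonelli in polar coordinates. [folklore] -/
theorem ofReal_norm_deriv_le_lintegral_closedBall {H : ℂ → ℂ} (hH : Differentiable ℂ H)
    (w₀ : ℂ) {R : ℝ} (hR : 0 < R) :
    ENNReal.ofReal (2 * π * R ^ 3 * ‖deriv H w₀‖) ≤
      ∫⁻ w in closedBall (0 : ℂ) (2 * R), ‖H (w₀ + w)‖ₑ := by
  -- the annulus `R ≤ ‖w‖ ≤ 2R`, the integrand, and its polar-coordinate form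
  obtain ⟨A, hA⟩ : ∃ A : Set ℂ, A = (fun w : ℂ => ‖w‖) ⁻¹' Icc R (2 * R) := ⟨_, rfl⟩
  have hAm : MeasurableSet A := hA ▸ measurable_norm measurableSet_Icc
  obtain ⟨f, hf⟩ : ∃ f : ℂ → ℝ≥0∞, f = A.indicator fun w => ‖H (w₀ + w)‖ₑ := ⟨_, rfl⟩
  have hHc : Continuous fun w : ℂ => H (w₀ + w) :=
    hH.continuous.comp (continuous_const.add continuous_id)
  have hfm : Measurable f := hf ▸ hHc.measurable.enorm.indicator hAm
  have hsymm : Continuous fun p : ℝ × ℝ => Complex.polarCoord.symm p := by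
    simp only [Complex.polarCoord_symm_apply]
    fun_prop
  obtain ⟨Φ, hΦ⟩ : ∃ Φ : ℝ × ℝ → ℝ≥0∞,
      Φ = fun p => ENNReal.ofReal p.1 * f (Complex.polarCoord.symm p) := ⟨_, rfl⟩
  have hΦm : Measurable Φ := hΦ ▸ measurable_fst.ennreal_ofReal.mul (hfm.comp hsymm.measurable)
  -- on `r ∈ [R, 2R]` the inner integral is `r` times the angle integral of `‖H‖`
  have hinner : ∀ r ∈ Icc R (2 * R), ∫⁻ θ in Ioo (-π) π, Φ (r, θ) =
      ENNReal.ofReal r * ∫⁻ θ in Ioo (-π) π, ‖H (circleMap w₀ r θ)‖ₑ := by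
    intro r hr
    have hr0 : 0 < r := hR.trans_le hr.1
    rw [← lintegral_const_mul' _ _ ENNReal.ofReal_ne_top]
    refine lintegral_congr fun θ => ?_
    have hmem : Complex.polarCoord.symm (r, θ) ∈ A := by
      rw [hA, mem_preimage, Complex.norm_polarCoord_symm, abs_of_pos hr0]
      exact hr
    rw [hΦ, hf]
    simp only [indicator_of_mem hmem, circleMap_eq_add_polarCoord_symm]
  calc ENNReal.ofReal (2 * π * R ^ 3 * ‖deriv H w₀‖)
      = ENNReal.ofReal (2 * π * R ^ 2 * ‖deriv H w₀‖) * volume (Icc R (2 * R)) := by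
        rw [Real.volume_Icc,
          ← ENNReal.ofReal_mul (by positivity : (0 : ℝ) ≤ 2 * π * R ^ 2 * ‖deriv H w₀‖)]
        congr 1
        ring
    _ = ∫⁻ _ in Icc R (2 * R), ENNReal.ofReal (2 * π * R ^ 2 * ‖deriv H w₀‖) :=
        (setLIntegral_const _ _).symm
    _ ≤ ∫⁻ r in Icc R (2 * R), ∫⁻ θ in Ioo (-π) π, Φ (r, θ) := by
        refine setLIntegral_mono' measurableSet_Icc fun r hr => ?_
        have hr0 : 0 < r := hR.trans_le hr.1
        have hRr : 2 * π * R ^ 2 * ‖deriv H w₀‖ ≤ r * (2 * π * r * ‖deriv H w₀‖) := by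
          have h1 : R ^ 2 ≤ r ^ 2 := pow_le_pow_left₀ hR.le hr.1 2
          have h2 : 0 ≤ 2 * π * ‖deriv H w₀‖ := by positivity
          calc 2 * π * R ^ 2 * ‖deriv H w₀‖ = R ^ 2 * (2 * π * ‖deriv H w₀‖) := by ring
            _ ≤ r ^ 2 * (2 * π * ‖deriv H w₀‖) := mul_le_mul_of_nonneg_right h1 h2
            _ = r * (2 * π * r * ‖deriv H w₀‖) := by ring
        rw [hinner r hr]
        calc ENNReal.ofReal (2 * π * R ^ 2 * ‖deriv H w₀‖)
            ≤ ENNReal.ofReal (r * (2 * π * r * ‖deriv H w₀‖)) := ENNReal.ofReal_le_ofReal hRr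
          _ = ENNReal.ofReal r * ENNReal.ofReal (2 * π * r * ‖deriv H w₀‖) :=
              ENNReal.ofReal_mul hr0.le
          _ ≤ ENNReal.ofReal r * ∫⁻ θ in Ioo (-π) π, ‖H (circleMap w₀ r θ)‖ₑ := by
              gcongr
              exact ofReal_two_pi_mul_norm_deriv_le_lintegral hH w₀ hr0
    _ ≤ ∫⁻ r in Ioi (0 : ℝ), ∫⁻ θ in Ioo (-π) π, Φ (r, θ) :=
        lintegral_mono_set fun r hr => hR.trans_le hr.1
    _ = ∫⁻ p in Ioi (0 : ℝ) ×ˢ Ioo (-π) π, Φ p := (setLIntegral_prod Φ hΦm.aemeasurable).symm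
    _ = ∫⁻ p in polarCoord.target, ENNReal.ofReal p.1 • f (Complex.polarCoord.symm p) := by
        rw [hΦ]
        rfl
    _ = ∫⁻ w, f w := Complex.lintegral_comp_polarCoord_symm f
    _ = ∫⁻ w in A, ‖H (w₀ + w)‖ₑ := by rw [hf, lintegral_indicator hAm]
    _ ≤ ∫⁻ w in closedBall (0 : ℂ) (2 * R), ‖H (w₀ + w)‖ₑ := by
        refine lintegral_mono_set fun w hw => ?_
        rw [hA] at hw
        rw [mem_closedBall_zero_iff]
        exact hw.2

/-- **Removing the weight on a disc.**  For `0 ≤ γ`, `R ≥ 0` and `‖w‖ ≤ 2R` one has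
`1 + ‖w₀ + w‖ ≤ M := 1 + ‖w₀‖ + 2R`, so `‖H(w₀ + w)‖ ≤ M ^ γ · ‖H(w₀ + w)‖ (1 + ‖w₀ + w‖) ^ (-γ)`;
integrating and using translation invariance of Lebesgue measure on `ℂ`,
`∫_{|w| ≤ 2R} ‖H(w₀ + w)‖ ≤ M ^ γ ∫ ‖H‖ (1 + ‖·‖) ^ (-γ)`. [folklore] -/
theorem lintegral_closedBall_le_weighted (H : ℂ → ℂ) {γ : ℝ} (hγ : 0 ≤ γ) (w₀ : ℂ) {R : ℝ}
    (hR : 0 ≤ R) :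
    ∫⁻ w in closedBall (0 : ℂ) (2 * R), ‖H (w₀ + w)‖ₑ ≤
      ENNReal.ofReal ((1 + ‖w₀‖ + 2 * R) ^ γ) * ∫⁻ w, ‖(‖H w‖ * (1 + ‖w‖) ^ (-γ))‖ₑ := by
  have hpt : ∀ w ∈ closedBall (0 : ℂ) (2 * R), (‖H (w₀ + w)‖ₑ : ℝ≥0∞) ≤
      ENNReal.ofReal ((1 + ‖w₀‖ + 2 * R) ^ γ) *
        ‖(‖H (w₀ + w)‖ * (1 + ‖w₀ + w‖) ^ (-γ))‖ₑ := by
    intro w hw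
    rw [mem_closedBall_zero_iff] at hw
    have hz : 1 + ‖w₀ + w‖ ≤ 1 + ‖w₀‖ + 2 * R := by
      have := norm_add_le w₀ w
      linarith
    have hpos : 0 < 1 + ‖w₀ + w‖ := by positivity
    have hgnn : 0 ≤ ‖H (w₀ + w)‖ * (1 + ‖w₀ + w‖) ^ (-γ) := by positivity
    have key : ‖H (w₀ + w)‖ ≤
        (1 + ‖w₀‖ + 2 * R) ^ γ * (‖H (w₀ + w)‖ * (1 + ‖w₀ + w‖) ^ (-γ)) := by
      have h1 : (1 + ‖w₀ + w‖) ^ γ ≤ (1 + ‖w₀‖ + 2 * R) ^ γ := Real.rpow_le_rpow hpos.le hz hγ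
      have hγpos : 0 < (1 + ‖w₀ + w‖) ^ γ := Real.rpow_pos_of_pos hpos γ
      rw [Real.rpow_neg hpos.le, show (1 + ‖w₀‖ + 2 * R) ^ γ * (‖H (w₀ + w)‖ *
          ((1 + ‖w₀ + w‖) ^ γ)⁻¹) = ‖H (w₀ + w)‖ * ((1 + ‖w₀‖ + 2 * R) ^ γ /
          (1 + ‖w₀ + w‖) ^ γ) by ring]
      exact le_mul_of_one_le_right (norm_nonneg _) ((one_le_div hγpos).2 h1)
    calc (‖H (w₀ + w)‖ₑ : ℝ≥0∞) = ENNReal.ofReal ‖H (w₀ + w)‖ := (ofReal_norm _).symm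
      _ ≤ ENNReal.ofReal ((1 + ‖w₀‖ + 2 * R) ^ γ *
            (‖H (w₀ + w)‖ * (1 + ‖w₀ + w‖) ^ (-γ))) := ENNReal.ofReal_le_ofReal key
      _ = ENNReal.ofReal ((1 + ‖w₀‖ + 2 * R) ^ γ) *
            ‖(‖H (w₀ + w)‖ * (1 + ‖w₀ + w‖) ^ (-γ))‖ₑ := by
          rw [ENNReal.ofReal_mul (by positivity), Real.enorm_eq_ofReal hgnn]
  calc ∫⁻ w in closedBall (0 : ℂ) (2 * R), ‖H (w₀ + w)‖ₑ
      ≤ ∫⁻ w in closedBall (0 : ℂ) (2 * R), ENNReal.ofReal ((1 + ‖w₀‖ + 2 * R) ^ γ) *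
          ‖(‖H (w₀ + w)‖ * (1 + ‖w₀ + w‖) ^ (-γ))‖ₑ :=
        setLIntegral_mono' measurableSet_closedBall hpt
    _ ≤ ∫⁻ w, ENNReal.ofReal ((1 + ‖w₀‖ + 2 * R) ^ γ) *
          ‖(‖H (w₀ + w)‖ * (1 + ‖w₀ + w‖) ^ (-γ))‖ₑ := setLIntegral_le_lintegral _ _
    _ = ENNReal.ofReal ((1 + ‖w₀‖ + 2 * R) ^ γ) *
          ∫⁻ w, ‖(‖H (w₀ + w)‖ * (1 + ‖w₀ + w‖) ^ (-γ))‖ₑ :=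
        lintegral_const_mul' _ _ ENNReal.ofReal_ne_top
    _ = ENNReal.ofReal ((1 + ‖w₀‖ + 2 * R) ^ γ) * ∫⁻ w, ‖(‖H w‖ * (1 + ‖w‖) ^ (-γ))‖ₑ := by
        rw [lintegral_add_left_eq_self (fun w : ℂ => (‖(‖H w‖ * (1 + ‖w‖) ^ (-γ))‖ₑ : ℝ≥0∞)) w₀]

/-- **Weighted Liouville, derivative form (`0 ≤ γ < 3`).**  If `H` is entire and
`w ↦ ‖H w‖ (1 + ‖w‖) ^ (-γ)` is Lebesgue integrable on `ℂ` with `0 ≤ γ < 3`, then `H' ≡ 0`: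
by the two previous estimates `2π R³ ‖H'(w₀)‖ ≤ (1 + ‖w₀‖ + 2R) ^ γ · I` for every `R > 0`,
and `R ^ (γ - 3) → 0`. [folklore] -/
theorem deriv_eq_zero_of_integrable_weight {H : ℂ → ℂ} {γ : ℝ} (hH : Differentiable ℂ H)
    (hγ0 : 0 ≤ γ) (hγ : γ < 3)
    (hint : Integrable (fun w : ℂ => ‖H w‖ * (1 + ‖w‖) ^ (-γ))) (w₀ : ℂ) :
    deriv H w₀ = 0 := by
  have hLfin : ∫⁻ w, ‖(‖H w‖ * (1 + ‖w‖) ^ (-γ))‖ₑ < ∞ := hint.hasFiniteIntegral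
  have hI : 0 ≤ (∫⁻ w, ‖(‖H w‖ * (1 + ‖w‖) ^ (-γ))‖ₑ).toReal := ENNReal.toReal_nonneg
  -- the basic inequality, for every `R > 0`
  have hbasic : ∀ R : ℝ, 0 < R → 2 * π * R ^ 3 * ‖deriv H w₀‖ ≤
      (1 + ‖w₀‖ + 2 * R) ^ γ * (∫⁻ w, ‖(‖H w‖ * (1 + ‖w‖) ^ (-γ))‖ₑ).toReal := by
    intro R hR
    have h := (ofReal_norm_deriv_le_lintegral_closedBall hH w₀ hR).trans
      (lintegral_closedBall_le_weighted H hγ0 w₀ hR.le)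
    have hne : ENNReal.ofReal ((1 + ‖w₀‖ + 2 * R) ^ γ) *
        ∫⁻ w, ‖(‖H w‖ * (1 + ‖w‖) ^ (-γ))‖ₑ ≠ ∞ :=
      ENNReal.mul_ne_top ENNReal.ofReal_ne_top hLfin.ne
    have h' := (ENNReal.ofReal_le_iff_le_toReal hne).1 h
    rwa [ENNReal.toReal_ofReal_mul _ _ (by positivity)] at h'
  -- let `R → ∞`
  have ht : Tendsto (fun R : ℝ => (3 : ℝ) ^ γ * (∫⁻ w, ‖(‖H w‖ * (1 + ‖w‖) ^ (-γ))‖ₑ).toReal /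
      (2 * π) * R ^ (γ - 3)) atTop (𝓝 0) := by
    have h := (tendsto_rpow_neg_atTop (by linarith : 0 < 3 - γ)).const_mul
      ((3 : ℝ) ^ γ * (∫⁻ w, ‖(‖H w‖ * (1 + ‖w‖) ^ (-γ))‖ₑ).toReal / (2 * π))
    simpa only [neg_sub, mul_zero] using h
  have hD0 : ‖deriv H w₀‖ ≤ 0 := by
    refine ge_of_tendsto ht ?_
    filter_upwards [eventually_ge_atTop (1 + ‖w₀‖)] with R hR
    have ha : 0 ≤ ‖w₀‖ := norm_nonneg _
    have hR0 : 0 < R := by linarith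
    have h2 : (1 + ‖w₀‖ + 2 * R) ^ γ ≤ (3 : ℝ) ^ γ * R ^ γ := by
      rw [← Real.mul_rpow (by norm_num) hR0.le]
      exact Real.rpow_le_rpow (by positivity) (by linarith) hγ0
    have h3 := (hbasic R hR0).trans (mul_le_mul_of_nonneg_right h2 hI)
    have hR3 : R ^ (γ - 3) = R ^ γ / R ^ (3 : ℕ) := by
      rw [Real.rpow_sub hR0, Real.rpow_ofNat]
    rw [hR3, div_mul_div_comm, le_div_iff₀ (by positivity)]
    calc ‖deriv H w₀‖ * (2 * π * R ^ 3) = 2 * π * R ^ 3 * ‖deriv H w₀‖ := by ring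
      _ ≤ 3 ^ γ * R ^ γ * (∫⁻ w, ‖(‖H w‖ * (1 + ‖w‖) ^ (-γ))‖ₑ).toReal := h3
      _ = 3 ^ γ * (∫⁻ w, ‖(‖H w‖ * (1 + ‖w‖) ^ (-γ))‖ₑ).toReal * R ^ γ := by ring
  exact norm_eq_zero.1 (le_antisymm hD0 (norm_nonneg _))

/-- **Weighted Liouville theorem (registered sub-goal `entire_eq_const_of_integrable_weight`).**
An entire function `H` such that `w ↦ ‖H w‖ (1 + ‖w‖) ^ (-γ)` is Lebesgue integrable on `ℂ`
for some `γ < 3` is constant.  (Reduce to `γ⁺ = max γ 0 ∈ [0, 3)` by monotonicity of the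
weight, then `H' ≡ 0` by `deriv_eq_zero_of_integrable_weight` and
`is_const_of_deriv_eq_zero`.)  The exponent `3` is sharp: `H w = w` is integrable against
`(1 + ‖w‖) ^ (-γ)` for every `γ > 3`. [folklore] -/
theorem entire_eq_const_of_integrable_weight : ∀ (H : ℂ → ℂ) (γ : ℝ), Differentiable ℂ H → γ < 3 → MeasureTheory.Integrable (fun w : ℂ => ‖H w‖ * (1 + ‖w‖) ^ (-γ)) → ∀ w : ℂ, H w = H 0 := by
  intro H γ hH hγ hint w
  -- reduce to the non-negative exponent `max γ 0 < 3`
  have hcont : Continuous fun z : ℂ => ‖H z‖ * (1 + ‖z‖) ^ (-max γ 0) :=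
    hH.continuous.norm.mul ((continuous_const.add continuous_norm).rpow_const
      fun z => Or.inl (add_pos_of_pos_of_nonneg one_pos (norm_nonneg z)).ne')
  have hint' : Integrable (fun z : ℂ => ‖H z‖ * (1 + ‖z‖) ^ (-max γ 0)) := by
    refine hint.mono' hcont.aestronglyMeasurable (Eventually.of_forall fun z => ?_)
    rw [Real.norm_of_nonneg (by positivity)]
    refine mul_le_mul_of_nonneg_left ?_ (norm_nonneg _)
    exact Real.rpow_le_rpow_of_exponent_le (by linarith [norm_nonneg z])
      (neg_le_neg (le_max_left γ 0))
  have hd : ∀ z, deriv H z = 0 :=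
    deriv_eq_zero_of_integrable_weight hH (le_max_right γ 0) (max_lt hγ (by norm_num)) hint'
  exact is_const_of_deriv_eq_zero hH hd w 0

end Summit.CriticalPhenomena.SAWScalingLimit.Theorems.PolygonParitySqueeze.Analysis

end
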